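import Literature.Computability.Complexity.AOWWalkMoments
import Literature.Computability.Complexity.AOWOddConfigs
import HarnessLib

/-!
# The moment bound for AOW's odd matrix (Allen–O'Donnell–Witmer 2015, Lemma A.2)

Trunk T-CPLX-CORE (Literature/Computability/Complexity). Support file for the discharge of the
named fact `allen_odonnell_witmer_kSAT` (`AOWRefutation.lean`), probabilistic part VII.

Let `T ∼ subsetPMF Λ p`, let the labels lie over triples in `I × I × K` (at most `λ₀` over each
triple) with signs `|ε| ≤ 1`, let `w_T(i,j,ℓ) = ∑_{λ over (i,j,ℓ)} ε_λ (1[λ ∈ T] - p)`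
(`randTensor`) and `A_T = oddMatrixOf w_T` (AOW's matrix, eq. (A-def)). With `N = |I|`, `ν = |K|`,
`m = n + 1` and the regime `N² ν p² ≥ 1`, we prove (`subsetExp_trace_pow_oddMatrixOf_le`)

  `E tr((A_TᵀA_T)^m) ≤ λ₀^{2m} λ₀^{2m} · (2m+3) m · (4m)^{4m-1} (2m)^{2m-1} · N^4 (N² ν p²)^m`,

AOW's Lemma A.2 (`E tr((AAᵀ)^r) ≤ n^{O(k)} 2^{O(r)} r^{6r} p^{2r} n^{kr}`, there with
`N = n^{(k-1)/2}`, `ν = n`, `|w| ≤ 1`), by their argument: expansion over configurations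
(`AOWOddConfigs`), `|E ∏ (ξ - p)| ≤ p^{#distinct labels}` and vanishing on singletons
(`AOWProductLaw`), `#distinct labels ≥ u ≥ max(2b, a - 3)` and `u ≤ 2m` (Claims 6–9, via
`AOWScanChains`), counting by `(a, b)` and Claim 10.

## References

* S. R. Allen, R. O'Donnell, D. Witmer, *How to refute a random CSP*, FOCS 2015,
  arXiv:1505.04383, App. A.4, Lemma A.2 and its proof (Claims 5–10).
-/

noncomputable section

namespace Literature.Computability.Complexity

open Finset Matrix

variable {I K Λ : Type} [Fintype I] [Fintype K] [Fintype Λ]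
variable [DecidableEq I] [DecidableEq K] [DecidableEq Λ]

/-! ### Label products over an arbitrary finite index type -/

/-- Every value of `f` is taken at least twice. [Allen–O'Donnell–Witmer 2015, App. A.4] [folklore] -/
def NoSingleton' {S X : Type} (f : S → X) : Prop := ∀ s, ∃ s', s' ≠ s ∧ f s' = f s

omit [Fintype Λ] [DecidableEq Λ] in
/-- `NoSingleton'` along an equivalence with `Fin`. [folklore] -/
theorem noSingleton'_iff_noSingleton {S : Type} [Fintype S] (e : S ≃ Fin (Fintype.card S)) (f : S → Λ) :
    NoSingleton' f ↔ NoSingleton (f ∘ e.symm) := by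
  constructor
  · intro h t
    obtain ⟨s', hs', hfs⟩ := h (e.symm t)
    refine ⟨e s', fun ht => hs' ?_, by simpa using hfs⟩
    rw [← ht, Equiv.symm_apply_apply]
  · intro h s
    obtain ⟨t', ht', hft⟩ := h (e s)
    refine ⟨e.symm t', fun hs => ht' ?_, by simpa using hft⟩
    rw [← hs, Equiv.apply_symm_apply]

/-- **The expectation of a label product over any finite index type** is at most
`p^{#distinct labels}` if every label occurs twice and `0` otherwise.
[Allen–O'Donnell–Witmer 2015, App. A.4] [cite: arXiv150504383, App. A] -/
theorem abs_subsetExp_prod_fintype_le {S : Type} [Fintype S] {p : ℝ} (hp0 : 0 ≤ p) (hp1 : p ≤ 1)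
    (f : S → Λ) [Decidable (NoSingleton' f)] :
    |subsetExp Λ p (fun T => ∏ s, (ind T (f s) - p))| ≤
      if NoSingleton' f then p ^ (univ.image f).card else 0 := by
  classical
  set e := Fintype.equivFin S
  have hprod : (fun T : Finset Λ => ∏ s, (ind T (f s) - p)) =
      fun T => ∏ t, (ind T ((f ∘ e.symm) t) - p) := by
    funext T
    exact (Equiv.prod_comp e.symm (fun s => ind T (f s) - p)).symm
  have himg : univ.image f = univ.image (f ∘ e.symm) := by
    ext x
    simp only [Finset.mem_image, Finset.mem_univ, true_and, Function.comp_apply]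
    exact ⟨fun ⟨s, hs⟩ => ⟨e s, by simpa using hs⟩, fun ⟨t, ht⟩ => ⟨e.symm t, ht⟩⟩
  rw [hprod, himg]
  have h := abs_subsetExp_prod_seq_le hp0 hp1 (f ∘ e.symm)
  by_cases hns : NoSingleton' f
  · rw [if_pos hns]
    rw [if_pos ((noSingleton'_iff_noSingleton e f).1 hns)] at h
    exact h
  · rw [if_neg hns]
    rw [if_neg (fun h' => hns ((noSingleton'_iff_noSingleton e f).2 h'))] at h
    exact h

/-! ### The random tensor and the per-configuration bound -/

/-- **The random tensor** `w_T(i,j,ℓ) = ∑_{λ over (i,j,ℓ)} ε_λ (1[λ ∈ T] - p)`.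
[Allen–O'Donnell–Witmer 2015, App. A.2 with Cor. 4.2] [cite: arXiv150504383, App. A.2] -/
def randTensor (b₁ b₂ : Λ → I) (lst : Λ → K) (ε : Λ → ℝ) (p : ℝ) (T : Finset Λ) : I → I → K → ℝ :=
  tensorOf b₁ b₂ lst fun x => ε x * (ind T x - p)

variable {n : ℕ}

/-- The weight attached to a configuration with `a` blocks and `b` last coordinates:
`p^{max(2b, a-3)}` within the ranges `1 ≤ a ≤ 2m+3`, `1 ≤ b ≤ m`, and `0` outside.
[Allen–O'Donnell–Witmer 2015, App. A.4 (`E[P_{J,L}] ≤ p^{max(2|L|, |J|-2)}`)] [cite: arXiv150504383, App. A] -/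
def oddWeight (p : ℝ) (m a b : ℕ) : ℝ :=
  if 1 ≤ a ∧ a ≤ 2 * m + 3 ∧ 1 ≤ b ∧ b ≤ m then p ^ max (2 * b) (a - 3) else 0

/-- `0 ≤ oddWeight`. [folklore] -/
theorem oddWeight_nonneg {p : ℝ} (hp0 : 0 ≤ p) (m a b : ℕ) : 0 ≤ oddWeight p m a b := by
  unfold oddWeight
  split_ifs <;> positivity

/-- **The bound on one configuration's expectation** (AOW Claims 6–9 combined): on a valid
configuration, `|E[∏_σ g(lab σ) g(lab' σ)]| ≤ oddWeight p m a b` with `a` the number of blocks,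
`b` the number of last coordinates, `g = ε · (ξ - p)`. [Allen–O'Donnell–Witmer 2015, App. A.4,
Claims 6–9] [cite: arXiv150504383, App. A] -/
theorem abs_subsetExp_term_le_oddWeight (b₁ b₂ : Λ → I) (lst : Λ → K) (ε : Λ → ℝ)
    (hε : ∀ x, |ε x| ≤ 1) {p : ℝ} (hp0 : 0 ≤ p) (hp1 : p ≤ 1) {P Q : Fin (n + 1) → I × I}
    {ℓ : Fin (n + 1) × Fin 2 → K} {lab lab' : Fin (n + 1) × Fin 2 → Λ}
    (hv : Valid b₁ b₂ lst P Q ℓ lab lab') :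
    |subsetExp Λ p (fun T => ∏ σ, (ε (lab σ) * (ind T (lab σ) - p)) * (ε (lab' σ) * (ind T (lab' σ) - p)))| ≤
      oddWeight p (n + 1) (blockSet P Q).card (univ.image ℓ).card := by
  classical
  -- factor the signs and flatten the two label families onto `slots ⊕ slots`
  set elim : (Fin (n + 1) × Fin 2) ⊕ (Fin (n + 1) × Fin 2) → Λ := Sum.elim lab lab' with helim
  have hfac : (fun T : Finset Λ =>
      ∏ σ, (ε (lab σ) * (ind T (lab σ) - p)) * (ε (lab' σ) * (ind T (lab' σ) - p))) =
      fun T => (∏ σ, ε (lab σ) * ε (lab' σ)) * ∏ x, (ind T (elim x) - p) := by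
    funext T
    rw [Fintype.prod_sum_type]
    simp only [helim, Sum.elim_inl, Sum.elim_inr, ← Finset.prod_mul_distrib]
    exact Finset.prod_congr rfl fun σ _ => by ring
  rw [hfac, subsetExp_const_mul, abs_mul]
  have hsign : |∏ σ, ε (lab σ) * ε (lab' σ)| ≤ 1 := by
    rw [Finset.abs_prod]
    refine Finset.prod_le_one (fun σ _ => abs_nonneg _) fun σ _ => ?_
    rw [abs_mul]
    exact mul_le_one₀ (hε _) (abs_nonneg _) (hε _)
  refine (mul_le_of_le_one_left (abs_nonneg _) hsign).trans ?_
  refine (abs_subsetExp_prod_fintype_le hp0 hp1 elim).trans ?_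
  split_ifs with hns
  · -- Claims 6–9
    set u := (tripleSet P Q ℓ).card with hu
    have himg : univ.image (labelTriples b₁ b₂ lst lab lab') = tripleSet P Q ℓ :=
      hv.image_labelTriples_eq
    have hud : u ≤ (univ.image elim).card := by
      rw [hu, ← himg]
      have : univ.image (labelTriples b₁ b₂ lst lab lab') =
          (univ.image elim).image (tripleOfLabel b₁ b₂ lst) := by
        rw [Finset.image_image]
        rfl
      rw [this]
      exact Finset.card_image_le
    have hns' : ∀ x, ∃ x', x' ≠ x ∧ labelTriples b₁ b₂ lst lab lab' x' = labelTriples b₁ b₂ lst lab lab' x := by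
      intro x
      obtain ⟨x', hx', hxx⟩ := hns x
      exact ⟨x', hx', by simp only [labelTriples]; rw [← helim, hxx]⟩
    have h2u : 2 * u ≤ (n + 1) * 2 + (n + 1) * 2 := by
      have := two_mul_card_image_le_card (labelTriples b₁ b₂ lst lab lab') hns'
      rwa [himg, Fintype.card_sum, Fintype.card_prod, Fintype.card_fin, Fintype.card_fin] at this
    have h2b : 2 * (univ.image ℓ).card ≤ u := two_mul_card_image_lst_le P Q ℓ hv.tripleAt_ne
    have ha : (blockSet P Q).card ≤ u + 3 := card_blockSet_le P Q ℓ
    have hb1 : 1 ≤ (univ.image ℓ).card :=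
      Finset.card_pos.2 ⟨ℓ (0, 0), Finset.mem_image_of_mem _ (Finset.mem_univ _)⟩
    have ha1 : 1 ≤ (blockSet P Q).card :=
      Finset.card_pos.2 ⟨blockOf (0 : Fin 2) (P 0), Finset.mem_union_left _
        (Finset.mem_image.2 ⟨((0 : Fin (n + 1)), (0 : Fin 2)), Finset.mem_univ _, rfl⟩)⟩
    rw [oddWeight, if_pos ⟨ha1, by omega, hb1, by omega⟩]
    exact pow_le_pow_of_le_one hp0 hp1 ((max_le (by omega) (by omega) : max _ _ ≤ u).trans hud)
  · exact oddWeight_nonneg hp0 _ _ _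

/-! ### Summing the weights over all configurations -/

/-- Reordering a fourfold sum over finsets. [folklore] -/
theorem sum_four_comm' {α β γ δ : Type} (s : Finset α) (t : Finset β) (u : Finset γ) (v : Finset δ)
    (f : α → β → γ → δ → ℝ) :
    ∑ a ∈ s, ∑ b ∈ t, ∑ c ∈ u, ∑ d ∈ v, f a b c d = ∑ c ∈ u, ∑ d ∈ v, ∑ a ∈ s, ∑ b ∈ t, f a b c d := by
  calc ∑ a ∈ s, ∑ b ∈ t, ∑ c ∈ u, ∑ d ∈ v, f a b c d
      = ∑ a ∈ s, ∑ c ∈ u, ∑ b ∈ t, ∑ d ∈ v, f a b c d :=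
        Finset.sum_congr rfl fun a _ => Finset.sum_comm
    _ = ∑ c ∈ u, ∑ a ∈ s, ∑ b ∈ t, ∑ d ∈ v, f a b c d := Finset.sum_comm
    _ = ∑ c ∈ u, ∑ a ∈ s, ∑ d ∈ v, ∑ b ∈ t, f a b c d :=
        Finset.sum_congr rfl fun c _ => Finset.sum_congr rfl fun a _ => Finset.sum_comm
    _ = ∑ c ∈ u, ∑ d ∈ v, ∑ a ∈ s, ∑ b ∈ t, f a b c d :=
        Finset.sum_congr rfl fun c _ => Finset.sum_comm

/-- **The sum of the weights over all `(P, Q, ℓ)`** (counting by `(a, b)` and Claim 10):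
`∑_{(P,Q)} ∑_ℓ oddWeight ≤ (2m+3) m (4m)^{4m-1} (2m)^{2m-1} N^4 (N² ν p²)^m` (`N = |I|`, `ν = |K|`,
`N² ν p² ≥ 1`). [Allen–O'Donnell–Witmer 2015, App. A.4 (the final summation and Claim 10)] [cite: arXiv150504383, App. A] -/
theorem sum_oddWeight_le {p : ℝ} (hp0 : 0 ≤ p) (hp1 : p ≤ 1)
    (hreg : 1 ≤ (Fintype.card I : ℝ) ^ 2 * Fintype.card K * p ^ 2) (n : ℕ) :
    ∑ PQ : (Fin (n + 1) → I × I) × (Fin (n + 1) → I × I), ∑ ℓ : Fin (n + 1) × Fin 2 → K,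
        oddWeight p (n + 1) (blockSet PQ.1 PQ.2).card (univ.image ℓ).card ≤
      ((2 * (n + 1) + 3) * (n + 1) : ℕ) *
        ((((n + 1) * 4 : ℕ) : ℝ) ^ ((n + 1) * 4 - 1) * (((n + 1) * 2 : ℕ) : ℝ) ^ ((n + 1) * 2 - 1)) *
          ((Fintype.card I : ℝ) ^ 4 *
            ((Fintype.card I : ℝ) ^ 2 * Fintype.card K * p ^ 2) ^ (n + 1)) := by
  -- `N, ν ≥ 1` from the regime
  have hN1 : (1 : ℝ) ≤ Fintype.card I := by
    have h0 : Fintype.card I ≠ 0 := by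
      intro h0
      rw [h0] at hreg
      norm_num at hreg
    exact_mod_cast Nat.one_le_iff_ne_zero.2 h0
  have hν1 : (1 : ℝ) ≤ Fintype.card K := by
    have h0 : Fintype.card K ≠ 0 := by
      intro h0
      rw [h0] at hreg
      norm_num at hreg
    exact_mod_cast Nat.one_le_iff_ne_zero.2 h0
  -- group by `(a, b)`
  have hgrp : ∀ (PQ : (Fin (n + 1) → I × I) × (Fin (n + 1) → I × I)) (ℓ : Fin (n + 1) × Fin 2 → K),
      oddWeight p (n + 1) (blockSet PQ.1 PQ.2).card (univ.image ℓ).card ≤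
        ∑ a ∈ Finset.Icc 1 (2 * (n + 1) + 3), ∑ b ∈ Finset.Icc 1 (n + 1),
          (if (blockSet PQ.1 PQ.2).card = a then (1 : ℝ) else 0) *
            ((if (univ.image ℓ).card = b then (1 : ℝ) else 0) * p ^ max (2 * b) (a - 3)) := by
    intro PQ ℓ
    unfold oddWeight
    split_ifs with hr
    · obtain ⟨ha1, ha2, hb1, hb2⟩ := hr
      have hterm := Finset.single_le_sum (s := Finset.Icc 1 (2 * (n + 1) + 3))
          (f := fun a => ∑ b ∈ Finset.Icc 1 (n + 1),
            (if (blockSet PQ.1 PQ.2).card = a then (1 : ℝ) else 0) *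
              ((if (univ.image ℓ).card = b then (1 : ℝ) else 0) * p ^ max (2 * b) (a - 3)))
          (fun a _ => Finset.sum_nonneg fun b _ => by positivity)
          (Finset.mem_Icc.2 ⟨ha1, ha2⟩)
      refine le_trans ?_ hterm
      have hterm' := Finset.single_le_sum (s := Finset.Icc 1 (n + 1)) (f := fun b =>
          (if (blockSet PQ.1 PQ.2).card = (blockSet PQ.1 PQ.2).card then (1 : ℝ) else 0) *
            ((if (univ.image ℓ).card = b then (1 : ℝ) else 0) *
              p ^ max (2 * b) ((blockSet PQ.1 PQ.2).card - 3)))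
          (fun b _ => by positivity) (Finset.mem_Icc.2 ⟨hb1, hb2⟩)
      refine le_trans (le_of_eq ?_) hterm'
      simp
    · exact Finset.sum_nonneg fun a _ => Finset.sum_nonneg fun b _ => by positivity
  -- the count for fixed `(a, b)`
  have hcount : ∀ a ∈ Finset.Icc 1 (2 * (n + 1) + 3), ∀ b ∈ Finset.Icc 1 (n + 1),
      ∑ PQ : (Fin (n + 1) → I × I) × (Fin (n + 1) → I × I), ∑ ℓ : Fin (n + 1) × Fin 2 → K,
        (if (blockSet PQ.1 PQ.2).card = a then (1 : ℝ) else 0) *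
          ((if (univ.image ℓ).card = b then (1 : ℝ) else 0) * p ^ max (2 * b) (a - 3)) ≤
        ((((n + 1) * 4 : ℕ) : ℝ) ^ ((n + 1) * 4 - 1) * (((n + 1) * 2 : ℕ) : ℝ) ^ ((n + 1) * 2 - 1)) *
          ((Fintype.card I : ℝ) ^ 4 *
            ((Fintype.card I : ℝ) ^ 2 * Fintype.card K * p ^ 2) ^ (n + 1)) := by
    intro a ha b hb
    obtain ⟨ha1, ha2⟩ := Finset.mem_Icc.1 ha
    obtain ⟨hb1, hb2⟩ := Finset.mem_Icc.1 hb
    -- factor the double sum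
    have hfact : ∑ PQ : (Fin (n + 1) → I × I) × (Fin (n + 1) → I × I), ∑ ℓ : Fin (n + 1) × Fin 2 → K,
        (if (blockSet PQ.1 PQ.2).card = a then (1 : ℝ) else 0) *
          ((if (univ.image ℓ).card = b then (1 : ℝ) else 0) * p ^ max (2 * b) (a - 3)) =
        (((univ : Finset ((Fin (n + 1) → I × I) × (Fin (n + 1) → I × I))).filter
            fun PQ => (blockSet PQ.1 PQ.2).card = a).card : ℝ) *
          ((((univ : Finset (Fin (n + 1) × Fin 2 → K)).filter fun ℓ => (univ.image ℓ).card = b).card : ℝ) *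
            p ^ max (2 * b) (a - 3)) := by
      rw [← Finset.sum_mul_sum, Finset.sum_boole, ← Finset.sum_mul, Finset.sum_boole]
    rw [hfact]
    have hc1 : (((univ : Finset ((Fin (n + 1) → I × I) × (Fin (n + 1) → I × I))).filter
        fun PQ => (blockSet PQ.1 PQ.2).card = a).card : ℝ) ≤
        (((n + 1) * 4 : ℕ) : ℝ) ^ ((n + 1) * 4 - 1) * (Fintype.card I : ℝ) ^ a := by
      have h := card_filter_blockSet_le (I := I) (n := n) ha1
      have h' : ((Fintype.card I * ((n + 1) * 4) ^ ((n + 1) * 4 - 1) * Fintype.card I ^ (a - 1) : ℕ) : ℝ) =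
          (((n + 1) * 4 : ℕ) : ℝ) ^ ((n + 1) * 4 - 1) * (Fintype.card I : ℝ) ^ a := by
        obtain ⟨a', rfl⟩ := Nat.exists_eq_add_of_le ha1
        rw [show 1 + a' - 1 = a' from by omega]
        push_cast
        ring
      rw [← h']
      exact_mod_cast h
    have hc2 : ((((univ : Finset (Fin (n + 1) × Fin 2 → K)).filter fun ℓ => (univ.image ℓ).card = b).card : ℝ)) ≤
        (((n + 1) * 2 : ℕ) : ℝ) ^ ((n + 1) * 2 - 1) * (Fintype.card K : ℝ) ^ b := by
      have h := card_filter_image_lst_le (K := K) (n := n) hb1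
      have h' : ((Fintype.card K * ((n + 1) * 2) ^ ((n + 1) * 2 - 1) * Fintype.card K ^ (b - 1) : ℕ) : ℝ) =
          (((n + 1) * 2 : ℕ) : ℝ) ^ ((n + 1) * 2 - 1) * (Fintype.card K : ℝ) ^ b := by
        obtain ⟨b', rfl⟩ := Nat.exists_eq_add_of_le hb1
        rw [show 1 + b' - 1 = b' from by omega]
        push_cast
        ring
      rw [← h']
      exact_mod_cast h
    have h10 := claim10 hN1 hν1 hp0 hp1 hreg (m := n + 1) ha2 hb2
    calc _ ≤ ((((n + 1) * 4 : ℕ) : ℝ) ^ ((n + 1) * 4 - 1) * (Fintype.card I : ℝ) ^ a) *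
          (((((n + 1) * 2 : ℕ) : ℝ) ^ ((n + 1) * 2 - 1) * (Fintype.card K : ℝ) ^ b) *
            p ^ max (2 * b) (a - 3)) :=
          mul_le_mul hc1 (mul_le_mul_of_nonneg_right hc2 (by positivity)) (by positivity) (by positivity)
      _ = ((((n + 1) * 4 : ℕ) : ℝ) ^ ((n + 1) * 4 - 1) * (((n + 1) * 2 : ℕ) : ℝ) ^ ((n + 1) * 2 - 1)) *
          ((Fintype.card I : ℝ) ^ a * (Fintype.card K : ℝ) ^ b * p ^ max (2 * b) (a - 3)) := by ring
      _ ≤ _ := mul_le_mul_of_nonneg_left h10 (by positivity)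
  -- assemble
  calc ∑ PQ : (Fin (n + 1) → I × I) × (Fin (n + 1) → I × I), ∑ ℓ : Fin (n + 1) × Fin 2 → K,
        oddWeight p (n + 1) (blockSet PQ.1 PQ.2).card (univ.image ℓ).card
      ≤ ∑ PQ : (Fin (n + 1) → I × I) × (Fin (n + 1) → I × I), ∑ ℓ : Fin (n + 1) × Fin 2 → K,
          ∑ a ∈ Finset.Icc 1 (2 * (n + 1) + 3), ∑ b ∈ Finset.Icc 1 (n + 1),
            (if (blockSet PQ.1 PQ.2).card = a then (1 : ℝ) else 0) *
              ((if (univ.image ℓ).card = b then (1 : ℝ) else 0) * p ^ max (2 * b) (a - 3)) :=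
        Finset.sum_le_sum fun PQ _ => Finset.sum_le_sum fun ℓ _ => hgrp PQ ℓ
    _ = ∑ a ∈ Finset.Icc 1 (2 * (n + 1) + 3), ∑ b ∈ Finset.Icc 1 (n + 1),
          ∑ PQ : (Fin (n + 1) → I × I) × (Fin (n + 1) → I × I), ∑ ℓ : Fin (n + 1) × Fin 2 → K,
            (if (blockSet PQ.1 PQ.2).card = a then (1 : ℝ) else 0) *
              ((if (univ.image ℓ).card = b then (1 : ℝ) else 0) * p ^ max (2 * b) (a - 3)) :=
        sum_four_comm' _ _ _ _ _
    _ ≤ ∑ _a ∈ Finset.Icc 1 (2 * (n + 1) + 3), ∑ _b ∈ Finset.Icc 1 (n + 1),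
          ((((n + 1) * 4 : ℕ) : ℝ) ^ ((n + 1) * 4 - 1) * (((n + 1) * 2 : ℕ) : ℝ) ^ ((n + 1) * 2 - 1)) *
            ((Fintype.card I : ℝ) ^ 4 *
              ((Fintype.card I : ℝ) ^ 2 * Fintype.card K * p ^ 2) ^ (n + 1)) :=
        Finset.sum_le_sum fun a ha => Finset.sum_le_sum fun b hb => hcount a ha b hb
    _ = _ := by
        rw [Finset.sum_const, Finset.sum_const, Nat.card_Icc, Nat.card_Icc, Nat.add_sub_cancel,
          Nat.add_sub_cancel, smul_smul, nsmul_eq_mul]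
        push_cast
        ring

/-! ### The moment bound -/

/-- **AOW's Lemma A.2 (moment bound for the odd matrix)**: with at most `λ₀` labels over each
triple, `|ε| ≤ 1`, `0 ≤ p ≤ 1`, `N = |I|`, `ν = |K|`, `m = n+1` and `N² ν p² ≥ 1`,
`E tr((A_TᵀA_T)^m) ≤ λ₀^{2m} λ₀^{2m} (2m+3) m (4m)^{4m-1} (2m)^{2m-1} N^4 (N² ν p²)^m`.
[Allen–O'Donnell–Witmer 2015, App. A.4, Lemma A.2] [cite: arXiv150504383, Lemma A.2] -/
theorem subsetExp_trace_pow_oddMatrixOf_le (b₁ b₂ : Λ → I) (lst : Λ → K) (ε : Λ → ℝ)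
    (hε : ∀ x, |ε x| ≤ 1) {lam0 : ℕ}
    (hfib : ∀ τ : I × I × K, (univ.filter fun x => OverTriple b₁ b₂ lst x τ).card ≤ lam0)
    {p : ℝ} (hp0 : 0 ≤ p) (hp1 : p ≤ 1)
    (hreg : 1 ≤ (Fintype.card I : ℝ) ^ 2 * Fintype.card K * p ^ 2) (n : ℕ) :
    subsetExp Λ p (fun T =>
        (((oddMatrixOf (randTensor b₁ b₂ lst ε p T))ᵀ * oddMatrixOf (randTensor b₁ b₂ lst ε p T)) ^
          (n + 1)).trace) ≤
      ((lam0 : ℝ) ^ ((n + 1) * 2) * (lam0 : ℝ) ^ ((n + 1) * 2)) *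
        (((2 * (n + 1) + 3) * (n + 1) : ℕ) *
          ((((n + 1) * 4 : ℕ) : ℝ) ^ ((n + 1) * 4 - 1) * (((n + 1) * 2 : ℕ) : ℝ) ^ ((n + 1) * 2 - 1)) *
            ((Fintype.card I : ℝ) ^ 4 *
              ((Fintype.card I : ℝ) ^ 2 * Fintype.card K * p ^ 2) ^ (n + 1))) := by
  classical
  -- Step 1: expansion under the expectation
  have hexp : subsetExp Λ p (fun T =>
      (((oddMatrixOf (randTensor b₁ b₂ lst ε p T))ᵀ * oddMatrixOf (randTensor b₁ b₂ lst ε p T)) ^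
        (n + 1)).trace) =
      ∑ Q : Fin (n + 1) → I × I, ∑ P : Fin (n + 1) → I × I, ∑ ℓ : Fin (n + 1) × Fin 2 → K,
        ∑ lab : Fin (n + 1) × Fin 2 → Λ, ∑ lab' : Fin (n + 1) × Fin 2 → Λ,
          if Valid b₁ b₂ lst P Q ℓ lab lab' then
            subsetExp Λ p (fun T =>
              ∏ σ, (ε (lab σ) * (ind T (lab σ) - p)) * (ε (lab' σ) * (ind T (lab' σ) - p)))
          else 0 := by
    unfold randTensor
    simp only [trace_pow_oddMatrixOf_tensorOf]
    rw [subsetExp_sum]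
    refine Finset.sum_congr rfl fun Q _ => ?_
    rw [subsetExp_sum]
    refine Finset.sum_congr rfl fun P _ => ?_
    rw [subsetExp_sum]
    refine Finset.sum_congr rfl fun ℓ _ => ?_
    rw [subsetExp_sum]
    refine Finset.sum_congr rfl fun lab _ => ?_
    rw [subsetExp_sum]
    refine Finset.sum_congr rfl fun lab' _ => ?_
    rw [subsetExp_ite]
  rw [hexp]
  -- Step 2: bound each valid term by the weight of its `(P, Q, ℓ)`
  have hstep : ∀ (Q P : Fin (n + 1) → I × I) (ℓ : Fin (n + 1) × Fin 2 → K),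
      ∑ lab : Fin (n + 1) × Fin 2 → Λ, ∑ lab' : Fin (n + 1) × Fin 2 → Λ,
        (if Valid b₁ b₂ lst P Q ℓ lab lab' then
            subsetExp Λ p (fun T =>
              ∏ σ, (ε (lab σ) * (ind T (lab σ) - p)) * (ε (lab' σ) * (ind T (lab' σ) - p)))
          else 0) ≤
        oddWeight p (n + 1) (blockSet P Q).card (univ.image ℓ).card *
          ((lam0 : ℝ) ^ ((n + 1) * 2) * (lam0 : ℝ) ^ ((n + 1) * 2)) := by
    intro Q P ℓ
    calc _ ≤ ∑ lab : Fin (n + 1) × Fin 2 → Λ, ∑ lab' : Fin (n + 1) × Fin 2 → Λ,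
          (if Valid b₁ b₂ lst P Q ℓ lab lab' then
              oddWeight p (n + 1) (blockSet P Q).card (univ.image ℓ).card else 0) := by
          refine Finset.sum_le_sum fun lab _ => Finset.sum_le_sum fun lab' _ => ?_
          split_ifs with hv
          · exact (le_abs_self _).trans (abs_subsetExp_term_le_oddWeight b₁ b₂ lst ε hε hp0 hp1 hv)
          · rfl
      _ = oddWeight p (n + 1) (blockSet P Q).card (univ.image ℓ).card *
          ∑ lab : Fin (n + 1) × Fin 2 → Λ, ∑ lab' : Fin (n + 1) × Fin 2 → Λ,
            (if Valid b₁ b₂ lst P Q ℓ lab lab' then (1 : ℝ) else 0) := by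
          rw [Finset.mul_sum]
          refine Finset.sum_congr rfl fun lab _ => ?_
          rw [Finset.mul_sum]
          refine Finset.sum_congr rfl fun lab' _ => ?_
          split_ifs <;> simp
      _ ≤ _ := mul_le_mul_of_nonneg_left (sum_valid_labels_le b₁ b₂ lst hfib P Q ℓ)
            (oddWeight_nonneg hp0 _ _ _)
  calc _ ≤ ∑ Q : Fin (n + 1) → I × I, ∑ P : Fin (n + 1) → I × I, ∑ ℓ : Fin (n + 1) × Fin 2 → K,
        oddWeight p (n + 1) (blockSet P Q).card (univ.image ℓ).card *
          ((lam0 : ℝ) ^ ((n + 1) * 2) * (lam0 : ℝ) ^ ((n + 1) * 2)) :=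
        Finset.sum_le_sum fun Q _ => Finset.sum_le_sum fun P _ => Finset.sum_le_sum fun ℓ _ => hstep Q P ℓ
    _ = ((lam0 : ℝ) ^ ((n + 1) * 2) * (lam0 : ℝ) ^ ((n + 1) * 2)) *
        ∑ PQ : (Fin (n + 1) → I × I) × (Fin (n + 1) → I × I), ∑ ℓ : Fin (n + 1) × Fin 2 → K,
          oddWeight p (n + 1) (blockSet PQ.1 PQ.2).card (univ.image ℓ).card := by
        rw [Fintype.sum_prod_type_right, Finset.mul_sum]
        refine Finset.sum_congr rfl fun Q _ => ?_
        rw [Finset.mul_sum]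
        refine Finset.sum_congr rfl fun P _ => ?_
        rw [Finset.mul_sum]
        exact Finset.sum_congr rfl fun ℓ _ => by dsimp only; ring
    _ ≤ _ := mul_le_mul_of_nonneg_left (sum_oddWeight_le hp0 hp1 hreg n) (by positivity)

end Literature.Computability.Complexity
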